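import Mathlib.MeasureTheory.Integral.IntervalIntegral.Basic
import Mathlib.Analysis.Calculus.IteratedDeriv.Lemmas
import Mathlib.Analysis.Calculus.Deriv.CompMul
import Summits.NavierStokesRegularity.TurbBounds.LayerForm
import Summits.NavierStokesRegularity.TurbBounds.SpectralForm
import HarnessLib

/-!
# The P2 profile family: bulk drop (R-P2a) and Ra-free rescaling (R-P2b) PROVED — `SpectralReduction Nu → LayerReduction Nu`
(cell `pub-turb` / `turb-bounds`, v2 lane; files of record HOME/pub-turb-sos/P2-PROOF.md 2.3–2.5 (= paper Appendix A.7 (a)(b)), SPEC-P2.md §1 (1.1);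
refereed lemma sheet HOME/tribunal/t-lemmas.md passes 1–3, R-P2a / R-P2b PASS. Written by pub-turb-sos, planner-pub-turb-sos-g10-0.)

HONEST FRAMING: rigorous bounds for the stated PDE and boundary conditions; no claim about physical turbulence beyond the bound.

WHAT IS KERNEL-CHECKED HERE (real analysis over Mathlib; no `sorry`; standard axioms):
* `tauP δ η′` — the piecewise profile derivative of P2-PROOF (2.3): `−η′(z/δ)/(2δ)` on `[0, δ)`, `0` on `[δ, 1 − δ]`, `−η′((1 − z)/δ)/(2δ)` on `(1 − δ, 1]`;
* `profile_tauP` — for `0 < δ ≤ 1/2`, `η′ ∈ C⁰[0, 1]`, `∫₀¹ η′ = 1`: `τ′ ∈ L¹ ∩ L²`, `∫₀¹ τ′ = −1` (`τ(0) = 1`, `τ(1) = 0`) and `∫₀¹ τ′² = I₂/(2δ)`,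
  `I₂ = ∫₀¹ η′²` — so the bound (A2) of the member is `s·I₂/(2δ) − (s − 1) = (s·I₂/(2κ))·Ra^{1/2} − (s − 1)` at `δ = κ·Ra^{−1/2}`;
* `layerIntegrand_affine`, `layerForm_affine` — the EXACT rescaling identity R-P2b (P2-PROOF 2.5): under `z = δ(x + 1)/2` (bottom) or `z = 1 − δ(x + 1)/2`
  (top), `V(x) = Ra^{−1/2}·w(z)`, `Θ(x) = θ(z)`, `K = (kδ)²`, the rescaled layer integrand SPEC-P2 (1.1) is `δ²`·(mode integrand of P2-PROOF 2.2) and the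
  layer form is `2δ ∫_{layer} (mode integrand) dz`;
* `integral_botLayer_nonneg`, `integral_topLayer_nonneg` — hence (★) `LayerPositivity s κ η′` (layer form `≥ 0` on the ONE-SIDED class, all `K > 0`) gives
  `∫_{layer} ≥ 0` for every TWO-SIDED pair `(w, θ)` and every `k > 0` (a two-sided pair restricted to a layer and rescaled is one-sided admissible);
* bulk drop R-P2a (P2-PROOF 2.4): on `[δ, 1 − δ]` the profile is flat and the mode integrand is pointwise `≥ 0` (`SpectralForm.integral_modeIntegrand_nonneg_of_eqOn_zero`);
* `spectralConstraint_tauP` — so (★) implies the spectral constraint (A1) `Q_k ≥ 0` (all `k > 0`, two-sided class) for the P2 profile at every `Ra ≥ 4κ²`;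
* `layerReduction_of_spectralReduction` — THEREFORE the cited reduction theorem ALONE (`SpectralForm.SpectralReduction Nu`, [cite: DingKerswell2019, (13)–(16)]
  transcribed mode-wise) implies the v1 named hypothesis `LayerForm.LayerReduction Nu`; the row theorems `Results.<Row>.nusselt_bound` then hold from
  `SpectralReduction Nu` (+ the row's tail hypothesis where not yet proved), see `Results/P2Spectral.lean`.
NOT HERE: any formalisation of the Boussinesq equations, of `Nu`, or of the background method itself (that is the cited theorem).
-/

set_option linter.style.longLine false

noncomputable section

namespace Summit.NavierStokesRegularity.TurbBounds.P2Profile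

open MeasureTheory intervalIntegral Set
open Summit.NavierStokesRegularity.TurbBounds.LayerForm Summit.NavierStokesRegularity.TurbBounds.SpectralForm

/-! ## 1. The piecewise P2 profile (P2-PROOF (2.3)) -/
/-- Layer density `u ↦ −η′(u)/(2δ)`: the profile derivative in the layer variable `u = z/δ` (bottom) or `u = (1 − z)/δ` (top). -/
def lay (δ : ℝ) (ηp : ℝ → ℝ) (u : ℝ) : ℝ := -(ηp u) / (2 * δ)

/-- The P2 profile derivative `τ′` of layer thickness `δ` and shape `η′` (P2-PROOF (2.3)): `−η′(z/δ)/(2δ)` for `z < δ`, `0` for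
`δ ≤ z ≤ 1 − δ`, `−η′((1 − z)/δ)/(2δ)` for `z > 1 − δ` (so `τ = 1 + ∫₀ᶻ τ′` is `1 − η(z/δ)/2`, `1/2`, `η((1 − z)/δ)/2` respectively,
`η(ζ) = ∫₀^ζ η′`). A total function on `ℝ`; only its restriction to `[0, 1]` matters. -/
def tauP (δ : ℝ) (ηp : ℝ → ℝ) (z : ℝ) : ℝ :=
  if z < δ then lay δ ηp (z / δ) else if z ≤ 1 - δ then 0 else lay δ ηp ((1 - z) / δ)

variable {δ : ℝ} {ηp : ℝ → ℝ}

/-- Bottom layer: `τ′(z) = −η′(z/δ)/(2δ)` for `z < δ`. -/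
theorem tauP_of_lt {z : ℝ} (hz : z < δ) : tauP δ ηp z = lay δ ηp (z / δ) := by
  simp [tauP, hz]

/-- Bulk: `τ′(z) = 0` for `δ < z < 1 − δ`. -/
theorem tauP_of_mem_Ioo {z : ℝ} (hz : z ∈ Ioo δ (1 - δ)) : tauP δ ηp z = 0 := by
  have h1 : ¬ z < δ := not_lt.mpr hz.1.le
  simp [tauP, h1, hz.2.le]

/-- Top layer: `τ′(z) = −η′((1 − z)/δ)/(2δ)` for `z > 1 − δ` (when `δ ≤ 1 − δ`). -/
theorem tauP_of_gt (hδ' : δ ≤ 1 - δ) {z : ℝ} (hz : 1 - δ < z) : tauP δ ηp z = lay δ ηp ((1 - z) / δ) := by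
  have h1 : ¬ z < δ := not_lt.mpr (hδ'.trans hz.le)
  have h2 : ¬ z ≤ 1 - δ := not_le.mpr hz
  simp [tauP, h1, h2]

/-! ## 2. Integrability of the profile (`τ′ ∈ L¹ ∩ L²`) -/
/-- The bottom-layer density is continuous on `[0, δ]` when `η′` is continuous on `[0, 1]`. -/
theorem continuousOn_lay_bot (hδ : 0 < δ) (hcont : ContinuousOn ηp (Icc 0 1)) :
    ContinuousOn (fun z => lay δ ηp (z / δ)) (Icc 0 δ) := by
  have h1 : ContinuousOn (fun z => ηp (z / δ)) (Icc 0 δ) :=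
    hcont.comp (by fun_prop : Continuous fun z : ℝ => z / δ).continuousOn
      (fun z hz => ⟨div_nonneg hz.1 hδ.le, (div_le_one hδ).mpr hz.2⟩)
  show ContinuousOn (fun z => -(ηp (z / δ)) / (2 * δ)) (Icc 0 δ)
  exact h1.neg.div_const _

/-- The top-layer density is continuous on `[1 − δ, 1]` when `η′` is continuous on `[0, 1]`. -/
theorem continuousOn_lay_top (hδ : 0 < δ) (hcont : ContinuousOn ηp (Icc 0 1)) :
    ContinuousOn (fun z => lay δ ηp ((1 - z) / δ)) (Icc (1 - δ) 1) := by
  have h1 : ContinuousOn (fun z => ηp ((1 - z) / δ)) (Icc (1 - δ) 1) :=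
    hcont.comp (by fun_prop : Continuous fun z : ℝ => (1 - z) / δ).continuousOn
      (fun z hz => ⟨div_nonneg (by linarith [hz.2]) hδ.le, (div_le_one hδ).mpr (by linarith [hz.1])⟩)
  show ContinuousOn (fun z => -(ηp ((1 - z) / δ)) / (2 * δ)) (Icc (1 - δ) 1)
  exact h1.neg.div_const _

/-- `τ′` and `τ′²` are integrable on the bottom layer `[0, δ]`. -/
theorem intervalIntegrable_bot (hδ : 0 < δ) (hcont : ContinuousOn ηp (Icc 0 1)) :
    IntervalIntegrable (tauP δ ηp) volume 0 δ ∧ IntervalIntegrable (fun z => tauP δ ηp z ^ 2) volume 0 δ := by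
  have hc := continuousOn_lay_bot hδ hcont
  refine ⟨(hc.intervalIntegrable_of_Icc hδ.le).congr_uIoo ?_, ((hc.pow 2).intervalIntegrable_of_Icc hδ.le).congr_uIoo ?_⟩
  · rw [uIoo_of_le hδ.le]
    intro z hz
    exact (tauP_of_lt hz.2).symm
  · rw [uIoo_of_le hδ.le]
    intro z hz
    show lay δ ηp (z / δ) ^ 2 = tauP δ ηp z ^ 2
    rw [tauP_of_lt hz.2]

/-- `τ′` and `τ′²` are integrable on the bulk `[δ, 1 − δ]` (where they vanish a.e.). -/
theorem intervalIntegrable_bulk (hδ' : δ ≤ 1 - δ) :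
    IntervalIntegrable (tauP δ ηp) volume δ (1 - δ) ∧ IntervalIntegrable (fun z => tauP δ ηp z ^ 2) volume δ (1 - δ) := by
  have h0 : IntervalIntegrable (fun _ : ℝ => (0 : ℝ)) volume δ (1 - δ) := intervalIntegrable_const
  refine ⟨h0.congr_uIoo ?_, h0.congr_uIoo ?_⟩
  · rw [uIoo_of_le hδ']
    intro z hz
    exact (tauP_of_mem_Ioo hz).symm
  · rw [uIoo_of_le hδ']
    intro z hz
    show (0 : ℝ) = tauP δ ηp z ^ 2
    rw [tauP_of_mem_Ioo hz]
    norm_num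

/-- `τ′` and `τ′²` are integrable on the top layer `[1 − δ, 1]`. -/
theorem intervalIntegrable_top (hδ : 0 < δ) (hδ' : δ ≤ 1 - δ) (hcont : ContinuousOn ηp (Icc 0 1)) :
    IntervalIntegrable (tauP δ ηp) volume (1 - δ) 1 ∧ IntervalIntegrable (fun z => tauP δ ηp z ^ 2) volume (1 - δ) 1 := by
  have hc := continuousOn_lay_top hδ hcont
  have hle : 1 - δ ≤ 1 := by linarith
  refine ⟨(hc.intervalIntegrable_of_Icc hle).congr_uIoo ?_, ((hc.pow 2).intervalIntegrable_of_Icc hle).congr_uIoo ?_⟩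
  · rw [uIoo_of_le hle]
    intro z hz
    exact (tauP_of_gt hδ' hz.1).symm
  · rw [uIoo_of_le hle]
    intro z hz
    show lay δ ηp ((1 - z) / δ) ^ 2 = tauP δ ηp z ^ 2
    rw [tauP_of_gt hδ' hz.1]

/-! ## 3. The integrals `∫₀¹ τ′ = −1` and `∫₀¹ τ′² = I₂/(2δ)` (P2-PROOF (2.3)) -/
/-- `∫₀^δ −η′(z/δ)/(2δ) dz = −(1/2)∫₀¹ η′ = −1/2`. -/
theorem integral_lay_bot (hδ : 0 < δ) (hint : (∫ u in (0 : ℝ)..1, ηp u) = 1) :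
    (∫ z in (0 : ℝ)..δ, lay δ ηp (z / δ)) = -1 / 2 := by
  rw [intervalIntegral.integral_comp_div (lay δ ηp) hδ.ne', zero_div, div_self hδ.ne', smul_eq_mul]
  simp only [lay]
  rw [intervalIntegral.integral_div, intervalIntegral.integral_neg, hint, mul_div_assoc',
    div_eq_iff (by positivity : (2 * δ : ℝ) ≠ 0)]
  ring

/-- `∫₀^δ (η′(z/δ)/(2δ))² dz = I₂/(4δ)`. -/
theorem integral_lay_bot_sq (hδ : 0 < δ) :
    (∫ z in (0 : ℝ)..δ, lay δ ηp (z / δ) ^ 2) = I2 ηp / (4 * δ) := by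
  have h : (∫ z in (0 : ℝ)..δ, lay δ ηp (z / δ) ^ 2) = δ • ∫ u in (0 : ℝ) / δ..δ / δ, lay δ ηp u ^ 2 :=
    intervalIntegral.integral_comp_div (fun u => lay δ ηp u ^ 2) hδ.ne'
  rw [h, zero_div, div_self hδ.ne', smul_eq_mul]
  simp only [lay, neg_div, neg_sq, div_pow]
  rw [intervalIntegral.integral_div]
  unfold I2
  rw [mul_div_assoc', div_eq_div_iff (by positivity) (by positivity)]
  ring

/-- Top layer = bottom layer under `z ↦ 1 − z`: `∫_{1−δ}^1 f((1 − z)/δ) dz = ∫₀^δ f(z/δ) dz` (density). -/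
theorem integral_lay_top (hδ : 0 < δ) (hint : (∫ u in (0 : ℝ)..1, ηp u) = 1) :
    (∫ z in (1 - δ : ℝ)..1, lay δ ηp ((1 - z) / δ)) = -1 / 2 := by
  have h := intervalIntegral.integral_comp_sub_left (fun y => lay δ ηp (y / δ)) (1 : ℝ) (a := 1 - δ) (b := 1)
  simp only [sub_self, sub_sub_cancel] at h
  rw [h]
  exact integral_lay_bot hδ hint

/-- Same for the squared density: `∫_{1−δ}^1 (η′((1 − z)/δ)/(2δ))² dz = I₂/(4δ)`. -/
theorem integral_lay_top_sq (hδ : 0 < δ) :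
    (∫ z in (1 - δ : ℝ)..1, lay δ ηp ((1 - z) / δ) ^ 2) = I2 ηp / (4 * δ) := by
  have h := intervalIntegral.integral_comp_sub_left (fun y => lay δ ηp (y / δ) ^ 2) (1 : ℝ) (a := 1 - δ) (b := 1)
  simp only [sub_self, sub_sub_cancel] at h
  rw [h]
  exact integral_lay_bot_sq hδ

/-- The three pieces of `∫₀¹ τ′`: `−1/2`, `0`, `−1/2`. -/
theorem integral_tauP_pieces (hδ : 0 < δ) (hδ' : δ ≤ 1 - δ) (hint : (∫ u in (0 : ℝ)..1, ηp u) = 1) :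
    (∫ z in (0 : ℝ)..δ, tauP δ ηp z) = -1 / 2 ∧ (∫ z in δ..(1 - δ), tauP δ ηp z) = 0 ∧
      (∫ z in (1 - δ : ℝ)..1, tauP δ ηp z) = -1 / 2 := by
  refine ⟨?_, ?_, ?_⟩
  · rw [integral_congr_Ioo_of_le hδ.le (g := fun z => lay δ ηp (z / δ)) (fun z hz => tauP_of_lt hz.2)]
    exact integral_lay_bot hδ hint
  · rw [integral_congr_Ioo_of_le hδ' (g := fun _ => (0 : ℝ)) (fun z hz => tauP_of_mem_Ioo hz)]
    simp
  · rw [integral_congr_Ioo_of_le (by linarith) (g := fun z => lay δ ηp ((1 - z) / δ)) (fun z hz => tauP_of_gt hδ' hz.1)]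
    exact integral_lay_top hδ hint

/-- The three pieces of `∫₀¹ τ′²`: `I₂/(4δ)`, `0`, `I₂/(4δ)`. -/
theorem integral_tauP_sq_pieces (hδ : 0 < δ) (hδ' : δ ≤ 1 - δ) :
    (∫ z in (0 : ℝ)..δ, tauP δ ηp z ^ 2) = I2 ηp / (4 * δ) ∧ (∫ z in δ..(1 - δ), tauP δ ηp z ^ 2) = 0 ∧
      (∫ z in (1 - δ : ℝ)..1, tauP δ ηp z ^ 2) = I2 ηp / (4 * δ) := by
  refine ⟨?_, ?_, ?_⟩
  · rw [integral_congr_Ioo_of_le hδ.le (g := fun z => lay δ ηp (z / δ) ^ 2) (fun z hz => by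
      show tauP δ ηp z ^ 2 = lay δ ηp (z / δ) ^ 2; rw [tauP_of_lt hz.2])]
    exact integral_lay_bot_sq hδ
  · rw [integral_congr_Ioo_of_le hδ' (g := fun _ => (0 : ℝ)) (fun z hz => by
      show tauP δ ηp z ^ 2 = 0; rw [tauP_of_mem_Ioo hz]; norm_num)]
    simp
  · rw [integral_congr_Ioo_of_le (by linarith) (g := fun z => lay δ ηp ((1 - z) / δ) ^ 2) (fun z hz => by
      show tauP δ ηp z ^ 2 = lay δ ηp ((1 - z) / δ) ^ 2; rw [tauP_of_gt hδ' hz.1])]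
    exact integral_lay_top_sq hδ

/-- **The P2 profile is admissible and `∫₀¹ τ′² = I₂/(2δ)` (P2-PROOF (2.3)).** For `0 < δ ≤ 1/2`, `η′ ∈ C⁰[0, 1]`, `∫₀¹ η′ = 1`:
`τ′ ∈ L¹ ∩ L²(0, 1)`, `∫₀¹ τ′ = −1`, and `∫₀¹ τ′² = I₂/(2δ)`. -/
theorem profile_tauP (hδ : 0 < δ) (hδ' : δ ≤ 1 - δ) (hcont : ContinuousOn ηp (Icc 0 1))
    (hint : (∫ u in (0 : ℝ)..1, ηp u) = 1) :
    Profile (tauP δ ηp) ∧ (∫ z in (0 : ℝ)..1, tauP δ ηp z ^ 2) = I2 ηp / (2 * δ) := by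
  obtain ⟨b1, b2⟩ := intervalIntegrable_bot hδ hcont (ηp := ηp)
  obtain ⟨m1, m2⟩ := intervalIntegrable_bulk hδ' (δ := δ) (ηp := ηp)
  obtain ⟨t1, t2⟩ := intervalIntegrable_top hδ hδ' hcont (ηp := ηp)
  obtain ⟨i1, i2, i3⟩ := integral_tauP_pieces hδ hδ' hint
  obtain ⟨q1, q2, q3⟩ := integral_tauP_sq_pieces hδ hδ' (ηp := ηp)
  have total : (∫ z in (0 : ℝ)..1, tauP δ ηp z) = -1 := by
    rw [← integral_add_adjacent_intervals (b1.trans m1) t1, ← integral_add_adjacent_intervals b1 m1, i1, i2, i3]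
    norm_num
  have sq : (∫ z in (0 : ℝ)..1, tauP δ ηp z ^ 2) = I2 ηp / (2 * δ) := by
    rw [← integral_add_adjacent_intervals (b2.trans m2) t2, ← integral_add_adjacent_intervals b2 m2, q1, q2, q3]
    ring
  exact ⟨⟨(b1.trans m1).trans t1, (b2.trans m2).trans t2, total⟩, sq⟩

/-! ## 4. The exact rescaling R-P2b (P2-PROOF 2.5): layer form = `2δ ∫_{layer}` mode form -/
/-- Chain rule for an affine change of variable (no differentiability hypothesis is needed: Mathlib's `deriv` is `0` off the
differentiability set on both sides consistently): `(f(c·y + d))′ = c·f′(c·y + d)`. -/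
theorem deriv_affine (f : ℝ → ℝ) (c d x : ℝ) : deriv (fun y => f (c * y + d)) x = c * deriv f (c * x + d) := by
  have h := deriv_comp_mul_left c (fun u => f (u + d)) x
  simp only [smul_eq_mul, deriv_comp_add_const] at h
  exact h

/-- `(c₀·f(c·y + d))′ = c₀·c·f′(c·y + d)` as functions. -/
theorem deriv_affine' (f : ℝ → ℝ) (c₀ c d : ℝ) :
    deriv (fun y => c₀ * f (c * y + d)) = fun x => c₀ * c * deriv f (c * x + d) := by
  funext x
  rw [deriv_const_mul_field, deriv_affine]
  ring

/-- Pointwise form of `deriv_affine'`. -/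
theorem deriv_affine_apply (f : ℝ → ℝ) (c₀ c d x : ℝ) :
    deriv (fun y => c₀ * f (c * y + d)) x = c₀ * c * deriv f (c * x + d) := by
  rw [deriv_affine']

/-- Second derivative under the affine change of variable: `(c₀·f(c·y + d))″ = c₀·c²·f″(c·y + d)`. -/
theorem deriv2_affine_apply (f : ℝ → ℝ) (c₀ c d x : ℝ) :
    deriv (deriv (fun y => c₀ * f (c * y + d))) x = c₀ * c * c * deriv (deriv f) (c * x + d) := by
  rw [deriv_affine' f c₀ c d, deriv_affine' (deriv f) (c₀ * c) c d]

/-- **Rescaling identity R-P2b, pointwise (P2-PROOF 2.5 / SPEC-P2 (1.1)).** With `δ = κ/r` (`r = Ra^{1/2}`), `K = k²δ²`, the affine map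
`z = a·x + b`, `a = ±δ/2`, and the test pair `V(y) = r⁻¹·w(a·y + b)`, `Θ(y) = θ(a·y + b)`: if the profile satisfies
`τ′(a·x + b) = −η′((x + 1)/2)/(2δ)` at the point, then the rescaled layer integrand at `x` equals `δ²·`(mode integrand at `z = a·x + b`,
Rayleigh number `r²`). Pure algebra after the chain rule. -/
theorem layerIntegrand_affine {r s κ k a b x : ℝ} {ηp τp w θ : ℝ → ℝ} (hr : r ≠ 0) (hκ : κ ≠ 0) (hk : k ≠ 0)
    (ha : a = κ / r / 2 ∨ a = -(κ / r / 2)) (hτ : τp (a * x + b) = -(ηp ((x + 1) / 2)) / (2 * (κ / r))) :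
    layerIntegrand s κ ηp (k ^ 2 * (κ / r) ^ 2) (fun y => r⁻¹ * w (a * y + b)) (fun y => θ (a * y + b)) x
      = (κ / r) ^ 2 * modeIntegrand (r ^ 2) s τp k w θ (a * x + b) := by
  rcases ha with rfl | rfl <;>
  · simp only [layerIntegrand, gOf, modeIntegrand]
    rw [deriv2_affine_apply, deriv_affine_apply, deriv_affine, hτ]
    field_simp
    ring

/-- **Rescaling identity R-P2b for the forms.** Under the hypotheses of `layerIntegrand_affine` along the open interval `x ∈ (−1, 1)`:
`layerForm s κ η′ (k²δ²) V Θ = δ² · a⁻¹ · ∫_{a·(−1)+b}^{a·1+b} (mode integrand) dz` — i.e. `2δ ∫₀^δ` for the bottom layer (`a = δ/2`,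
`b = δ/2`) and `2δ ∫_{1−δ}^1` for the top layer (`a = −δ/2`, `b = 1 − δ/2`). -/
theorem layerForm_affine {r s κ k a b : ℝ} {ηp τp w θ : ℝ → ℝ} (hr : r ≠ 0) (hκ : κ ≠ 0) (hk : k ≠ 0)
    (ha : a = κ / r / 2 ∨ a = -(κ / r / 2))
    (hτ : ∀ x ∈ Ioo (-1 : ℝ) 1, τp (a * x + b) = -(ηp ((x + 1) / 2)) / (2 * (κ / r))) :
    layerForm s κ ηp (k ^ 2 * (κ / r) ^ 2) (fun y => r⁻¹ * w (a * y + b)) (fun y => θ (a * y + b))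
      = (κ / r) ^ 2 * (a⁻¹ * ∫ z in (a * (-1) + b)..(a * 1 + b), modeIntegrand (r ^ 2) s τp k w θ z) := by
  have ha0 : a ≠ 0 := by
    rcases ha with rfl | rfl <;> simp [hκ, hr]
  unfold layerForm
  rw [integral_congr_Ioo_of_le (by norm_num : (-1 : ℝ) ≤ 1)
      (g := fun x => (κ / r) ^ 2 * modeIntegrand (r ^ 2) s τp k w θ (a * x + b))
      (fun x hx => layerIntegrand_affine hr hκ hk ha (hτ x hx)),
    intervalIntegral.integral_const_mul, intervalIntegral.integral_comp_mul_add (modeIntegrand (r ^ 2) s τp k w θ) ha0 b,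
    smul_eq_mul]

/-! ## 5. Layer positivity (★) ⇒ the two layer integrals of the mode form are `≥ 0` on the two-sided class -/
/-- **Bottom layer.** If (★) `LayerPositivity s κ η′` holds then, for every two-sided pair `(w, θ)`, every `k > 0` and `δ = κ/r`
(`r > 0`, `r² = Ra`): `∫₀^δ (mode integrand of the P2 profile) dz ≥ 0`. Proof: the pair `V(x) = r⁻¹ w(δ(x+1)/2)`, `Θ(x) = θ(δ(x+1)/2)`
is one-sided admissible (wall conditions at `z = 0` ↦ `x = −1`), and by `layerForm_affine` its layer form at `K = k²δ²` is `2δ` times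
the integral in question. -/
theorem integral_botLayer_nonneg {Ra r s κ k : ℝ} {ηp w θ : ℝ → ℝ} (hr : 0 < r) (hrr : r ^ 2 = Ra) (hκ : 0 < κ) (hk : 0 < k)
    (hpos : LayerPositivity s κ ηp) (hwθ : TwoSided w θ) :
    0 ≤ ∫ z in (0 : ℝ)..(κ / r), modeIntegrand Ra s (tauP (κ / r) ηp) k w θ z := by
  have hδ : 0 < κ / r := div_pos hκ hr
  have hw : ContDiff ℝ 2 w := hwθ.hw
  have hθ : ContDiff ℝ 1 θ := hwθ.hθ
  have e0 : κ / r / 2 * (-1 : ℝ) + κ / r / 2 = 0 := by ring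
  have hOne : OneSided (fun y => r⁻¹ * w (κ / r / 2 * y + κ / r / 2)) (fun y => θ (κ / r / 2 * y + κ / r / 2)) := by
    refine ⟨by fun_prop, by fun_prop, ?_, ?_, ?_⟩
    · show r⁻¹ * w (κ / r / 2 * (-1) + κ / r / 2) = 0
      rw [e0, hwθ.w_bot, mul_zero]
    · rw [deriv_affine_apply, e0, hwθ.dw_bot, mul_zero]
    · show θ (κ / r / 2 * (-1) + κ / r / 2) = 0
      rw [e0, hwθ.θ_bot]
  have hτ : ∀ x ∈ Ioo (-1 : ℝ) 1, tauP (κ / r) ηp (κ / r / 2 * x + κ / r / 2) = -(ηp ((x + 1) / 2)) / (2 * (κ / r)) := by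
    intro x hx
    have hz : κ / r / 2 * x + κ / r / 2 < κ / r := by nlinarith [mul_pos hδ (sub_pos.mpr hx.2)]
    rw [tauP_of_lt hz]
    show -(ηp ((κ / r / 2 * x + κ / r / 2) / (κ / r))) / (2 * (κ / r)) = -(ηp ((x + 1) / 2)) / (2 * (κ / r))
    rw [show κ / r / 2 * x + κ / r / 2 = κ / r * ((x + 1) / 2) by ring, mul_div_cancel_left₀ _ hδ.ne']
  have hL := hpos (k ^ 2 * (κ / r) ^ 2) (by positivity) _ _ hOne
  rw [layerForm_affine hr.ne' hκ.ne' hk.ne' (Or.inl rfl) hτ, hrr, e0,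
    show κ / r / 2 * (1 : ℝ) + κ / r / 2 = κ / r by ring, ← mul_assoc] at hL
  have hc : 0 < (κ / r) ^ 2 * (κ / r / 2)⁻¹ := by positivity
  by_contra hneg
  have hlt : (∫ z in (0 : ℝ)..(κ / r), modeIntegrand Ra s (tauP (κ / r) ηp) k w θ z) < 0 := not_le.mp hneg
  have := mul_neg_of_pos_of_neg hc hlt
  linarith

/-- **Top layer.** Same with the reflected layer: for `δ = κ/r ≤ 1/2`, `∫_{1−δ}^1 (mode integrand of the P2 profile) dz ≥ 0` for every
two-sided pair and every `k > 0` (test pair `V(x) = r⁻¹ w(1 − δ(x+1)/2)`, `Θ(x) = θ(1 − δ(x+1)/2)`; wall conditions at `z = 1` ↦ `x = −1`;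
the orientation reversal is absorbed by `a⁻¹ = −2/δ` and `∫_1^{1−δ} = −∫_{1−δ}^1`). -/
theorem integral_topLayer_nonneg {Ra r s κ k : ℝ} {ηp w θ : ℝ → ℝ} (hr : 0 < r) (hrr : r ^ 2 = Ra) (hκ : 0 < κ) (hk : 0 < k)
    (hδ' : κ / r ≤ 1 - κ / r) (hpos : LayerPositivity s κ ηp) (hwθ : TwoSided w θ) :
    0 ≤ ∫ z in (1 - κ / r : ℝ)..1, modeIntegrand Ra s (tauP (κ / r) ηp) k w θ z := by
  have hδ : 0 < κ / r := div_pos hκ hr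
  have hw : ContDiff ℝ 2 w := hwθ.hw
  have hθ : ContDiff ℝ 1 θ := hwθ.hθ
  have e1 : -(κ / r / 2) * (-1 : ℝ) + (1 - κ / r / 2) = 1 := by ring
  have hOne : OneSided (fun y => r⁻¹ * w (-(κ / r / 2) * y + (1 - κ / r / 2)))
      (fun y => θ (-(κ / r / 2) * y + (1 - κ / r / 2))) := by
    refine ⟨by fun_prop, by fun_prop, ?_, ?_, ?_⟩
    · show r⁻¹ * w (-(κ / r / 2) * (-1) + (1 - κ / r / 2)) = 0
      rw [e1, hwθ.w_top, mul_zero]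
    · rw [deriv_affine_apply, e1, hwθ.dw_top, mul_zero]
    · show θ (-(κ / r / 2) * (-1) + (1 - κ / r / 2)) = 0
      rw [e1, hwθ.θ_top]
  have hτ : ∀ x ∈ Ioo (-1 : ℝ) 1,
      tauP (κ / r) ηp (-(κ / r / 2) * x + (1 - κ / r / 2)) = -(ηp ((x + 1) / 2)) / (2 * (κ / r)) := by
    intro x hx
    have hz : 1 - κ / r < -(κ / r / 2) * x + (1 - κ / r / 2) := by nlinarith [mul_pos hδ (sub_pos.mpr hx.2)]
    rw [tauP_of_gt hδ' hz]
    show -(ηp ((1 - (-(κ / r / 2) * x + (1 - κ / r / 2))) / (κ / r))) / (2 * (κ / r)) = -(ηp ((x + 1) / 2)) / (2 * (κ / r))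
    rw [show 1 - (-(κ / r / 2) * x + (1 - κ / r / 2)) = κ / r * ((x + 1) / 2) by ring, mul_div_cancel_left₀ _ hδ.ne']
  have hL := hpos (k ^ 2 * (κ / r) ^ 2) (by positivity) _ _ hOne
  rw [layerForm_affine hr.ne' hκ.ne' hk.ne' (Or.inr rfl) hτ, hrr, e1,
    show -(κ / r / 2) * (1 : ℝ) + (1 - κ / r / 2) = 1 - κ / r by ring,
    intervalIntegral.integral_symm (1 - κ / r) 1, inv_neg, neg_mul_neg, ← mul_assoc] at hL
  have hc : 0 < (κ / r) ^ 2 * (κ / r / 2)⁻¹ := by positivity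
  by_contra hneg
  have hlt : (∫ z in (1 - κ / r : ℝ)..1, modeIntegrand Ra s (tauP (κ / r) ηp) k w θ z) < 0 := not_le.mp hneg
  have := mul_neg_of_pos_of_neg hc hlt
  linarith

/-! ## 6. (★) ⇒ (A1) for the P2 profile, and `SpectralReduction → LayerReduction` -/
/-- **(★) implies the spectral constraint (A1) for the P2 profile (R-P2a + R-P2b; P2-PROOF 2.4–2.5).** For an admissible member
(`1 < s`, `0 < κ`, `η′ ∈ C⁰[0, 1]`) satisfying (★) `LayerPositivity s κ η′`, and every `Ra ≥ 4κ²` (so `δ = κ/√Ra ≤ 1/2`): the mode forms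
`Q_k` of the profile `tauP (κ/√Ra) η′` are `≥ 0` for all `k > 0` on the two-sided class — `∫₀¹ = ∫₀^δ + ∫_δ^{1−δ} + ∫_{1−δ}^1` with the two
layer integrals `≥ 0` by Section 5 and the bulk integral `≥ 0` pointwise (flat profile, `SpectralForm.integral_modeIntegrand_nonneg_of_eqOn_zero`). -/
theorem spectralConstraint_tauP {Ra s κ : ℝ} {ηp : ℝ → ℝ} (hs : 1 < s) (hκ : 0 < κ) (hcont : ContinuousOn ηp (Icc 0 1))
    (hpos : LayerPositivity s κ ηp) (hRa : 4 * κ ^ 2 ≤ Ra) :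
    SpectralConstraint Ra s (tauP (κ / Real.sqrt Ra) ηp) := by
  intro k hk w θ hwθ
  have hRa0 : 0 < Ra := lt_of_lt_of_le (by positivity) hRa
  set r := Real.sqrt Ra with hr_def
  have hr : 0 < r := by rw [hr_def]; exact Real.sqrt_pos.mpr hRa0
  have hrr : r ^ 2 = Ra := by rw [hr_def]; exact Real.sq_sqrt hRa0.le
  have h2κ : 2 * κ ≤ r := by rw [hr_def]; exact Real.le_sqrt_of_sq_le (by nlinarith)
  have hδ : 0 < κ / r := div_pos hκ hr
  have hδhalf : κ / r ≤ 1 / 2 := by rw [div_le_iff₀ hr]; linarith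
  have hδ' : κ / r ≤ 1 - κ / r := by linarith
  obtain ⟨b1, -⟩ := intervalIntegrable_bot hδ hcont (ηp := ηp)
  obtain ⟨m1, -⟩ := intervalIntegrable_bulk hδ' (δ := κ / r) (ηp := ηp)
  obtain ⟨t1, -⟩ := intervalIntegrable_top hδ hδ' hcont (ηp := ηp)
  have J1 := intervalIntegrable_modeIntegrand (Ra := Ra) (s := s) (k := k) b1 hwθ.hw hwθ.hθ
  have J2 := intervalIntegrable_modeIntegrand (Ra := Ra) (s := s) (k := k) m1 hwθ.hw hwθ.hθ
  have J3 := intervalIntegrable_modeIntegrand (Ra := Ra) (s := s) (k := k) t1 hwθ.hw hwθ.hθ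
  have P1 := integral_botLayer_nonneg (s := s) hr hrr hκ hk hpos hwθ
  have P2 : 0 ≤ ∫ z in (κ / r)..(1 - κ / r), modeIntegrand Ra s (tauP (κ / r) ηp) k w θ z :=
    integral_modeIntegrand_nonneg_of_eqOn_zero hs.le hRa0.le hδ' (fun z hz => tauP_of_mem_Ioo hz)
  have P3 := integral_topLayer_nonneg (s := s) hr hrr hκ hk hδ' hpos hwθ
  unfold modeForm
  rw [← integral_add_adjacent_intervals (J1.trans J2) J3, ← integral_add_adjacent_intervals J1 J2]
  linarith

/-- **MAIN THEOREM (R-P2a + R-P2b kernel-checked): the cited reduction theorem implies the v1 named hypothesis.**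
`SpectralReduction Nu → LayerReduction Nu`: given an admissible member with (★) and `Ra ≥ 4κ²`, apply the cited reduction to the P2
profile `tauP (κ/√Ra) η′` — admissible by `profile_tauP`, satisfying (A1) by `spectralConstraint_tauP` — and evaluate
`s ∫₀¹ τ′² − (s − 1) = s·I₂/(2δ) − (s − 1) = (s·I₂/(2κ))·√Ra − (s − 1)`. Consequently every row theorem stated from `LayerReduction`
holds from `SpectralReduction` (see `Results/P2Spectral.lean`). -/
theorem layerReduction_of_spectralReduction (Nu : ℝ → ℝ) (h : SpectralReduction Nu) : LayerReduction Nu := by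
  intro s κ ηp hs hκ hcont hint hpos Ra hRa
  have hRa0 : 0 < Ra := lt_of_lt_of_le (by positivity) hRa
  have hr : 0 < Real.sqrt Ra := Real.sqrt_pos.mpr hRa0
  have h2κ : 2 * κ ≤ Real.sqrt Ra := Real.le_sqrt_of_sq_le (by nlinarith)
  have hδ : 0 < κ / Real.sqrt Ra := div_pos hκ hr
  have hδhalf : κ / Real.sqrt Ra ≤ 1 / 2 := by rw [div_le_iff₀ hr]; linarith
  have hδ' : κ / Real.sqrt Ra ≤ 1 - κ / Real.sqrt Ra := by linarith
  obtain ⟨hprof, hsq⟩ := profile_tauP hδ hδ' hcont hint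
  have hSC := spectralConstraint_tauP hs hκ hcont hpos hRa
  have hb := h Ra s _ hRa0 hs hprof hSC
  rw [hsq] at hb
  have e : s * (I2 ηp / (2 * (κ / Real.sqrt Ra))) = s * I2 ηp / (2 * κ) * Real.sqrt Ra := by
    rw [show 2 * (κ / Real.sqrt Ra) = 2 * κ / Real.sqrt Ra by ring, div_div_eq_mul_div]
    ring
  linarith

end Summit.NavierStokesRegularity.TurbBounds.P2Profile

end
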